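import Summits.MatrixMultiplication.OmegaCensus.ThreeSetZ5Z5Cover44H1
import Summits.MatrixMultiplication.OmegaCensus.ThreeSetZ5Z5Cover44H2
import Summits.MatrixMultiplication.OmegaCensus.ThreeSetZ5Z5Cover44H3
import Summits.MatrixMultiplication.OmegaCensus.ThreeSetZ5Z5Cover44C12Lo
import Summits.MatrixMultiplication.OmegaCensus.ThreeSetZ5Z5Cover44C12Hi
import Summits.MatrixMultiplication.OmegaCensus.ThreeSetZ5Z5Cover44C19Lo
import Summits.MatrixMultiplication.OmegaCensus.ThreeSetZ5Z5Cover44C19Hi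
import Summits.MatrixMultiplication.OmegaCensus.ThreeSetZ5Z5Cover44C23Lo
import Summits.MatrixMultiplication.OmegaCensus.ThreeSetZ5Z5Cover44C23Hi
import Summits.MatrixMultiplication.OmegaCensus.ThreeSetZ5Z5Cover44C24Lo
import Summits.MatrixMultiplication.OmegaCensus.ThreeSetZ5Z5Cover44C24Hi
import HarnessLib

/-!
# Three-set `ℤ₅ × ℤ₅` cover, parts `4, 4` at `|A| = 625`: every multiset of size `4` has a certified direction, for every frame and hole

ω-census `pub-omega`, family (b3), seat pub-omega-group gen 36.  Framing: lottery ticket; floor = certified bounds/negative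
ranges.  VALUE: finite kernel computations behind `ThreeSetZ5Z5Cells44.lean` (census cell `(4,4,13)@625`); NOT progress on ω.

**`exists_cert44`**: for every frame index `ci < 25` (`Φ'(W) = T ∪ {pt 5 ci}`), hole position `σ < 25` and `g : Fin 25 → ℕ` with `Σ g = 4`
there is a direction `j ≤ 5` whose three-set line datum (line image `wvec44 ci j` of `W`, `cnts 5 j g`, hole value `pv 5 j σ`) carries
EITHER a modular Farkas certificate (`lineCert3At`, every order) OR an LP certificate at line fibre size `K = 125` (`farkasOK5`, `|A| = 625`).
-/

namespace Summit.MatrixMultiplication.OmegaCensus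

namespace Z5Z5ThreeSet

open ZpZpDomino

/-- Gluing the two hole ranges of a centroid frame. [folklore] -/
theorem of_halves {f : ℕ → Bool} (hlo : ((List.range 13).all f) = true) (hhi : (((List.range 12).map (13 + ·)).all f) = true) :
    ∀ σ < 25, f σ = true := by
  intro σ hσ
  rw [List.all_eq_true] at hlo hhi
  by_cases h : σ < 13
  · exact hlo σ (List.mem_range.2 h)
  · exact hhi σ (List.mem_map.2 ⟨σ - 13, List.mem_range.2 (by omega), by omega⟩)

/-- The per-frame computations, indexed: hole-independent form or per-hole form. [folklore] -/
theorem sound_cover44 (ci : ℕ) (hci : ci < 25) :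
    (soundChk3 5 4 (tree44hi ci) (certHI ci) = true ∧ cover3C 5 4 (tree44hi ci) = true) ∨
      (∀ σ < 25, (soundChk3 5 4 (tree44 ci σ) (certLP ci σ) && cover3C 5 4 (tree44 ci σ)) = true) := by
  have h : ci = 0 ∨ ci = 1 ∨ ci = 2 ∨ ci = 3 ∨ ci = 4 ∨ ci = 5 ∨ ci = 6 ∨ ci = 7 ∨ ci = 8 ∨ ci = 9 ∨ ci = 10 ∨ ci = 11 ∨ ci = 12 ∨ ci = 13 ∨ ci = 14 ∨ ci = 15 ∨ ci = 16 ∨ ci = 17 ∨ ci = 18 ∨ ci = 19 ∨ ci = 20 ∨ ci = 21 ∨ ci = 22 ∨ ci = 23 ∨ ci = 24 := by omega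
  rcases h with rfl | rfl | rfl | rfl | rfl | rfl | rfl | rfl | rfl | rfl | rfl | rfl | rfl | rfl | rfl | rfl | rfl | rfl | rfl | rfl | rfl | rfl | rfl | rfl | rfl
  · exact Or.inl (by simpa using hi44_0)
  · exact Or.inl (by simpa using hi44_1)
  · exact Or.inl (by simpa using hi44_2)
  · exact Or.inl (by simpa using hi44_3)
  · exact Or.inl (by simpa using hi44_4)
  · exact Or.inl (by simpa using hi44_5)
  · exact Or.inl (by simpa using hi44_6)
  · exact Or.inl (by simpa using hi44_7)
  · exact Or.inl (by simpa using hi44_8)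
  · exact Or.inl (by simpa using hi44_9)
  · exact Or.inl (by simpa using hi44_10)
  · exact Or.inl (by simpa using hi44_11)
  · exact Or.inr (of_halves c44_12_lo c44_12_hi)
  · exact Or.inl (by simpa using hi44_13)
  · exact Or.inl (by simpa using hi44_14)
  · exact Or.inl (by simpa using hi44_15)
  · exact Or.inl (by simpa using hi44_16)
  · exact Or.inl (by simpa using hi44_17)
  · exact Or.inl (by simpa using hi44_18)
  · exact Or.inr (of_halves c44_19_lo c44_19_hi)
  · exact Or.inl (by simpa using hi44_20)
  · exact Or.inl (by simpa using hi44_21)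
  · exact Or.inl (by simpa using hi44_22)
  · exact Or.inr (of_halves c44_23_lo c44_23_hi)
  · exact Or.inr (of_halves c44_24_lo c44_24_hi)

/-- **Every multiset of size `4` on `ℤ₅²` has a certified direction (modular, or LP at `K = 125`), for every frame `ci < 25` and hole `σ < 25`.**
[folklore] -/
theorem exists_cert44 (ci : ℕ) (hci : ci < 25) (σ : ℕ) (hσ : σ < 25) (g : Fin (5 * 5) → ℕ) (hg : ∑ i, g i = 4) :
    ∃ j < 6, (∃ certs : List (ℕ × List ℕ),
        lineCert3At 5 (vecFn (wvec44 ci j)) (vecFn (cnts 5 j g)) certs ((pv 5 j σ : ℕ) : ZMod 5) = true) ∨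
      ∃ z : List ℤ, farkasOK5 (wvec44 ci j) (cnts 5 j g) 125 z (pv 5 j σ) = true := by
  rcases sound_cover44 ci hci with ⟨hs, hc⟩ | h
  · obtain ⟨j, hj, hcert⟩ := exists_cert_of_cover3C (tree44hi ci) (certHI ci) hs hc g hg
    exact ⟨j, hj, Or.inl (lineCert3At_of_certHI hcert (pv 5 j σ) (pv_lt 5 j σ))⟩
  · have h2 := h σ hσ
    rw [Bool.and_eq_true] at h2
    obtain ⟨j, hj, hcert⟩ := exists_cert_of_cover3C (tree44 ci σ) (certLP ci σ) h2.1 h2.2 g hg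
    exact ⟨j, hj, of_certLP hcert⟩

end Z5Z5ThreeSet

end Summit.MatrixMultiplication.OmegaCensus
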